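import Literature.Geometry.Lorentzian.CarterAngularBarrier
import Literature.Geometry.Lorentzian.TeukolskyKernelRegimeReduction
import HarnessLib

/-!
# Inward growth of the infinity-normalised mode through the angular barrier: the two-point decay
# `‖u_𝓘(x′)‖ ≤ K·(R_b/min(ρ x′, R_Λ))^{√Λ/8}·‖u_𝓘(x_b)‖`
(namespace `Literature.Geometry.Lorentzian.Kerr`.)

Carter's radial equation `u″ + (ω² − V(ρ x))u = 0` (`V = Kerr.sepPotential M a ω m Λ`, `ρ` a tortoise
radius of a sub-extremal Kerr exterior, admissible `(ω, m, Λ)`, `ω ≠ 0`) and its solution `u_𝓘` with the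
data of the mode normalised at `𝓘⁺`: `‖u_𝓘‖ → 1`, `‖u_𝓘′‖ → |ω|` at `+∞`, flux `Im(ū_𝓘 u_𝓘′) ≡ ω`. In the
ANGULAR-DOMINATED regime `256·ω²R_Λ² ≤ Λ`, `Λ ≥ 64`, the radii `7M ≤ r ≤ 2R_Λ` form a forbidden zone with
rate `V − ω² ≥ Λ/(4r²)` (`CarterAngularBarrier.lean`), and `u_𝓘`, entering it from the oscillatory far side
at the outer turning point `β` with `‖u_𝓘′(β)‖ ≤ √2|ω|` (far Sonin energy), is recessive-dominated all the
way in (`BarrierInwardGrowth.lean`: depth `4ω² ≤ |ω|·g′(β)` from the shell `[R_Λ, 2R_Λ]`). Hence for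
`7M ≤ R_b ≤ R_Λ`, `ρ x_b = R_b` and every `x′` with `ρ x′ ≥ R_b`:

  `‖u_𝓘 x′‖ · (min(ρ x′, R_Λ)/R_b)^{√Λ/8} ≤ (6 + 6|ω|R_far)·‖u_𝓘 x_b‖`,
  `R_far = max(7M, √(12Λ)/|ω|, 1/(Mω²))`

(`angularBarrier_decay`; points inside the barrier by the two-point bound over the barrier basis and
the power decay of the recessive branch, points beyond `β` by the far envelope `‖u_𝓘‖ ≤ 2 + 2|ω|R_far`
against the total growth `d(x_b) ≤ 2√2‖u_𝓘(x_b)‖`). The `R`-language form for the normalised radial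
Teukolsky solution `R_𝓘` (`u_𝓘 = √(r² + a²)R_𝓘`) is `angularBarrier_decay_radial`. This is the extra
DECAY of the cone Green kernel between a near point and a far source point across the angular barrier
(near-extremal Kerr programme, summation of the κ-explicit integrated decay estimate): a classical
tunnelling estimate, here with every constant explicit and no asymptotics.

## References
* M. Dafermos, I. Rodnianski, Y. Shlapentokh-Rothman, arXiv:1402.7034 = Ann. of Math. 183 (2016),
  §5.2.3, §8.4; key `DafermosRodnianskiShlapentokhrothman2014`.
* R. Teixeira da Costa, Commun. Math. Phys. 378 (2020) = arXiv:1910.02854, Def. 2.3 (key `Costa2019`).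
* P. Hartman, *Ordinary Differential Equations* (SIAM Classics 38, 2002), Ch. XI §6. The assembly is
  folklore.
-/

noncomputable section

open Filter Set Complex Literature.Analysis.ODE
open scoped Topology ComplexConjugate

namespace Literature.Geometry.Lorentzian

namespace Kerr

/-! ### Scalar bookkeeping -/

/-- `16|ω|R_Λ ≤ √Λ` from `256·ω²R_Λ² ≤ Λ`. [folklore] -/
theorem sixteen_mul_le_sqrt_of_sq_le {ω RΛ Λ : ℝ} (hΛ : 256 * (ω ^ 2 * RΛ ^ 2) ≤ Λ) :
    16 * (|ω| * RΛ) ≤ Real.sqrt Λ := by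
  refine Real.le_sqrt_of_sq_le ?_
  calc (16 * (|ω| * RΛ)) ^ 2 = 256 * (|ω| ^ 2 * RΛ ^ 2) := by ring
    _ = 256 * (ω ^ 2 * RΛ ^ 2) := by rw [sq_abs]
    _ ≤ Λ := hΛ

/-- Bookkeeping for a point inside the barrier: from the two-point bound `V′·d_b ≤ 2(d₁ + Θ g₁)·V_b`,
the growth `d_y·P ≤ d_b·Q` (`d_y ≥ d₁ ≥ 1`, `0 ≤ g₁ ≤ g_β`, `Θ ≥ 0`, `d_b, Q > 0`, `P ≥ 0`) and
`2(1 + Θ g_β) ≤ K`: `V′·(P/Q) ≤ K·V_b`. [folklore] -/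
theorem inside_bookkeeping {V' Vb db d₁ dy g₁ gβ Θ P Q K : ℝ} (hVb : 0 ≤ Vb) (hdb : 0 < db) (hd₁ : 1 ≤ d₁) (hdy : d₁ ≤ dy) (hg₁ : 0 ≤ g₁) (hg : g₁ ≤ gβ) (hΘ : 0 ≤ Θ)
    (hP : 0 ≤ P) (hQ : 0 < Q) (h1 : V' * db ≤ 2 * (d₁ + Θ * g₁) * Vb) (h2 : dy * P ≤ db * Q)
    (hK : 2 * (1 + Θ * gβ) ≤ K) : V' * (P / Q) ≤ K * Vb := by
  rw [mul_div_assoc', div_le_iff₀ hQ]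
  -- `d₁ + Θ g₁ ≤ d₁ (1 + Θ g_β)`
  have h3 : d₁ + Θ * g₁ ≤ d₁ * (1 + Θ * gβ) := by
    have : Θ * g₁ ≤ Θ * gβ * d₁ := by
      calc Θ * g₁ ≤ Θ * gβ := mul_le_mul_of_nonneg_left hg hΘ
        _ = Θ * gβ * 1 := (mul_one _).symm
        _ ≤ Θ * gβ * d₁ := mul_le_mul_of_nonneg_left hd₁ (mul_nonneg hΘ (hg₁.trans hg))
    linarith
  have hgβ : 0 ≤ gβ := hg₁.trans hg
  have hC : 0 ≤ 2 * (1 + Θ * gβ) * Vb :=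
    mul_nonneg (mul_nonneg zero_le_two (by nlinarith [mul_nonneg hΘ hgβ])) hVb
  have h4 : V' * db * P ≤ 2 * (1 + Θ * gβ) * Vb * (db * Q) := by
    calc V' * db * P ≤ 2 * (d₁ + Θ * g₁) * Vb * P :=
          mul_le_mul_of_nonneg_right h1 hP
      _ ≤ 2 * (d₁ * (1 + Θ * gβ)) * Vb * P :=
          mul_le_mul_of_nonneg_right (mul_le_mul_of_nonneg_right
            (mul_le_mul_of_nonneg_left h3 zero_le_two) hVb) hP
      _ = 2 * (1 + Θ * gβ) * Vb * (d₁ * P) := by ring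
      _ ≤ 2 * (1 + Θ * gβ) * Vb * (dy * P) :=
          mul_le_mul_of_nonneg_left (mul_le_mul_of_nonneg_right hdy hP) hC
      _ ≤ 2 * (1 + Θ * gβ) * Vb * (db * Q) := mul_le_mul_of_nonneg_left h2 hC
  have h5 : V' * P ≤ 2 * (1 + Θ * gβ) * Vb * Q := by
    have : V' * P * db ≤ 2 * (1 + Θ * gβ) * Vb * Q * db := by
      calc V' * P * db = V' * db * P := by ring
        _ ≤ 2 * (1 + Θ * gβ) * Vb * (db * Q) := h4
        _ = 2 * (1 + Θ * gβ) * Vb * Q * db := by ring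
    exact le_of_mul_le_mul_right this hdb
  calc V' * P ≤ 2 * (1 + Θ * gβ) * Vb * Q := h5
    _ ≤ K * Vb * Q := mul_le_mul_of_nonneg_right (mul_le_mul_of_nonneg_right hK hVb) hQ.le

/-- Bookkeeping for a point beyond the barrier: `V′ ≤ P_far`, `0 ≤ d_b ≤ 3V_b`, `P ≤ d_b·Q` (`Q > 0`)
give `V′·(P/Q) ≤ 3P_far·V_b`. [folklore] -/
theorem far_bookkeeping {V' Vb db P Q Pfar : ℝ} (hV' : 0 ≤ V') (hPfar : V' ≤ Pfar) (hdb0 : 0 ≤ db)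
    (hdb : db ≤ 3 * Vb) (hQ : 0 < Q) (hPQ : P ≤ db * Q) : V' * (P / Q) ≤ 3 * Pfar * Vb := by
  have hP0 : 0 ≤ Pfar := hV'.trans hPfar
  rw [mul_div_assoc', div_le_iff₀ hQ]
  calc V' * P ≤ V' * (db * Q) := mul_le_mul_of_nonneg_left hPQ hV'
    _ = V' * db * Q := by ring
    _ ≤ Pfar * (3 * Vb) * Q :=
        mul_le_mul_of_nonneg_right (mul_le_mul hPfar hdb hdb0 hP0) hQ.le
    _ = 3 * Pfar * Vb * Q := by ring

/-! ### The decay estimate in the tortoise variable -/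

section Tortoise

variable {M a ω Λ : ℝ} {m : ℤ} {ρ : ℝ → ℝ} {v v₁ : ℝ → ℂ}

set_option maxHeartbeats 400000 in
-- the construction (turning point, basis, depth) and the two position cases in one statement
/-- **Inward growth of the `𝓘⁺`-normalised mode through the angular barrier.** Let `ρ` be a tortoise
radius (`|a| < M`), `(ω, m, Λ)` admissible with `ω ≠ 0`, `256·ω²R_Λ² ≤ Λ`, `Λ ≥ 64`, `7M ≤ R_b ≤ R_Λ`, and
let `v` solve `v″ + (ω² − V(ρ x))v = 0` with `‖v‖ → 1`, `‖v′‖ → |ω|` at `+∞` and flux `Im(v̄ v′) ≡ ω`. Then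
for `ρ x_b = R_b` and every `x′` with `ρ x′ ≥ R_b`:
`‖v x′‖·(min(ρ x′, R_Λ)/R_b)^{√Λ/8} ≤ (6 + 6|ω|·max(7M, √(12Λ)/|ω|, 1/(Mω²)))·‖v x_b‖`. [folklore] -/
theorem angularBarrier_decay (hρ : IsTortoiseRadius M a ρ) (hMa : IsSubextremal M a)
    (hadm : IsAdmissibleTriple a ω m Λ) (hω : ω ≠ 0) {RΛ Rb : ℝ}
    (hΛ : 256 * (ω ^ 2 * RΛ ^ 2) ≤ Λ) (hΛ64 : 64 ≤ Λ) (hRb : 7 * M ≤ Rb) (hRbΛ : Rb ≤ RΛ)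
    (hv : ∀ x, HasDerivAt v (v₁ x) x ∧
      HasDerivAt v₁ (-(((ω ^ 2 - sepPotential M a ω m Λ (ρ x) : ℝ) : ℂ) * v x)) x)
    (hlim : Tendsto (fun x ↦ ‖v x‖) atTop (𝓝 1)) (hlim₁ : Tendsto (fun x ↦ ‖v₁ x‖) atTop (𝓝 |ω|))
    (hflux : ∀ x, (conj (v x) * v₁ x).im = ω)
    {xb x' : ℝ} (hxb : ρ xb = Rb) (hx' : Rb ≤ ρ x') :
    ‖v x'‖ * (min (ρ x') RΛ / Rb) ^ (Real.sqrt Λ / 8) ≤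
      (6 + 6 * |ω| * max (7 * M) (max (Real.sqrt (12 * Λ) / |ω|) (1 / (M * ω ^ 2)))) * ‖v xb‖ := by
  have hM : 0 < M := hMa.pos
  have haM : |a| ≤ M := le_of_lt hMa
  have hmono := (hρ.strictMono hMa).monotone
  set Rfar := max (7 * M) (max (Real.sqrt (12 * Λ) / |ω|) (1 / (M * ω ^ 2))) with hRfar
  set p := Real.sqrt Λ / 8 with hp
  have hRb0 : 0 < Rb := by linarith
  have hRΛ0 : 0 < RΛ := by linarith
  have hω0 : 0 < |ω| := abs_pos.2 hω
  have hsΛ : 8 ≤ Real.sqrt Λ := by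
    rw [show (8 : ℝ) = Real.sqrt (8 ^ 2) by rw [Real.sqrt_sq (by norm_num)]]
    exact Real.sqrt_le_sqrt (by linarith)
  have h16 : 16 * (|ω| * RΛ) ≤ Real.sqrt Λ := sixteen_mul_le_sqrt_of_sq_le hΛ
  -- the points `x₁`, `x₂` with `ρ x₁ = R_Λ`, `ρ x₂ = 2R_Λ`
  have hrp : rPlus M a < Rb := by linarith [rPlus_le_two_mul_self hM.le a]
  obtain ⟨x₁, hx₁⟩ := hρ.exists_apply_eq (show rPlus M a < RΛ by linarith)
  obtain ⟨x₂, hx₂⟩ := hρ.exists_apply_eq (show rPlus M a < 2 * RΛ by linarith)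
  have hxb7 : 7 * M ≤ ρ xb := by rw [hxb]; exact hRb
  have hxb1 : xb ≤ x₁ := by rw [← hρ.le_iff_le hMa, hxb, hx₁]; exact hRbΛ
  have hx12 : x₁ ≤ x₂ := by rw [← hρ.le_iff_le hMa, hx₁, hx₂]; linarith
  have hx₂7 : 7 * M ≤ ρ x₂ := by rw [hx₂]; linarith
  have hxbx' : xb ≤ x' := by rw [← hρ.le_iff_le hMa, hxb]; exact hx'
  -- the outer turning point `β ≥ x₂`
  have hφ₂ : ω ^ 2 - sepPotential M a ω m Λ (ρ x₂) ≤ 0 := by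
    have h := angularBarrier_rate hM haM hadm hΛ hx₂7 (by rw [hx₂])
    have : 0 ≤ Λ / (4 * ρ x₂ ^ 2) := by have := hadm.nonneg; positivity
    linarith
  obtain ⟨β, hx₂β, hφβ, hneg, hpos, hρβ⟩ := exists_angular_turningPoint hρ hMa hadm hω hx₂7 hφ₂
  have hxbβ : xb ≤ β := hxb1.trans (hx12.trans hx₂β)
  have hβ7 : 7 * M ≤ ρ β := hx₂7.trans (hmono hx₂β)
  -- the equation in the form `y″ = q y`, `q = V ∘ ρ − ω² ≥ 0` on `[x_b, β]`
  have hv' : ∀ x, HasDerivAt v (v₁ x) x ∧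
      HasDerivAt v₁ (((sepPotential M a ω m Λ (ρ x) - ω ^ 2 : ℝ) : ℂ) * v x) x := fun x ↦
    ⟨(hv x).1, (hv x).2.congr_deriv (by push_cast; ring)⟩
  have hqc : Continuous fun s ↦ sepPotential M a ω m Λ (ρ s) - ω ^ 2 := by
    refine continuous_iff_continuousAt.2 fun s ↦ ?_
    have h := (hρ.hasDerivAt_omega_sq_sub_sepPotential hMa ω m Λ s).continuousAt.neg
    exact h.congr (Eventually.of_forall fun y ↦ by simp only [Pi.neg_apply]; ring)
  have hq0 : ∀ s ∈ Icc xb β, 0 ≤ sepPotential M a ω m Λ (ρ s) - ω ^ 2 := fun s hs ↦ by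
    have := hneg s (hxb7.trans (hmono hs.1)) hs.2; linarith
  -- the barrier basis on `[x_b, β]`
  obtain ⟨g, g', d, d', hgg, hdd, hgα, hg'α, hdβ, hd'β, hsign, hgm, hdm, hW, -, -⟩ :=
    exists_barrierBasis hqc hxbβ hq0
  have hg : ∀ s ∈ Icc xb β, HasDerivAt g (g' s) s ∧
      HasDerivAt g' ((sepPotential M a ω m Λ (ρ s) - ω ^ 2) * g s) s := fun s _ ↦ hgg s
  have hd : ∀ s ∈ Icc xb β, HasDerivAt d (d' s) s ∧
      HasDerivAt d' ((sepPotential M a ω m Λ (ρ s) - ω ^ 2) * d s) s := fun s _ ↦ hdd s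
  -- depth and the outer end rate from the shell `[R_Λ, 2R_Λ]`
  obtain ⟨hw₀, hgβ⟩ := depth_and_endRate_of_angularBarrier hρ hMa hadm hΛ hΛ64 hxb7 hxb1 hx₁ hx₂
    hx₂β hg hq0 fun s hs ↦ ⟨(hsign s hs).1, (hsign s hs).2.1⟩
  have hw₀pos : 0 < g' β := lt_of_lt_of_le (by positivity) hw₀
  -- the right data of `v` at `β`
  have hP₁ : ‖v₁ β‖ ≤ Real.sqrt 2 * |ω| := carter_far_norm_deriv_le hρ hMa hadm hv hlim hlim₁ hβ7 hφβ.ge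
  have hdeep : 2 * (Real.sqrt 2 * |ω|) ^ 2 ≤ |ω| * g' β := by
    have e : 2 * (Real.sqrt 2 * |ω|) ^ 2 = 4 * |ω| * |ω| := by
      rw [mul_pow, Real.sq_sqrt (by norm_num : (0 : ℝ) ≤ 2)]; ring
    rw [e]
    have h1 : 4 * |ω| ≤ g' β := by
      refine le_trans ?_ hw₀
      rw [le_div_iff₀ (by positivity)]; nlinarith
    nlinarith
  have hΘ : (Real.sqrt 2 * |ω|) ^ 2 / (|ω| * g' β) = 2 * |ω| / g' β := by
    rw [mul_pow, Real.sq_sqrt (by norm_num : (0 : ℝ) ≤ 2), sq_abs, ← sq_abs ω]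
    field_simp
  have hvI : ∀ s ∈ Icc xb β, HasDerivAt v (v₁ s) s ∧
      HasDerivAt v₁ (((sepPotential M a ω m Λ (ρ s) - ω ^ 2 : ℝ) : ℂ) * v s) s := fun s _ ↦ hv' s
  -- `Θ g(β) ≤ (14/5)|ω| R_far + 1`
  have hΘg : 2 * |ω| / g' β * g β ≤ 14 / 5 * (|ω| * Rfar) + 1 := by
    have h1 : g β / g' β ≤ (β - x₂) + 8 * RΛ / Real.sqrt Λ := by
      rw [div_le_iff₀ hw₀pos]; exact hgβ
    have h2 : β - x₂ ≤ 7 / 5 * Rfar := by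
      have := hρ.sub_le_mul_sub hMa hx₂β hx₂7
      have hρx₂ : 0 ≤ ρ x₂ := (hρ.pos hMa x₂).le
      linarith
    have h3 : 2 * |ω| * (8 * RΛ / Real.sqrt Λ) ≤ 1 := by
      rw [mul_div_assoc', div_le_one (by linarith)]; linarith
    calc 2 * |ω| / g' β * g β = 2 * |ω| * (g β / g' β) := by ring
      _ ≤ 2 * |ω| * ((β - x₂) + 8 * RΛ / Real.sqrt Λ) := mul_le_mul_of_nonneg_left h1 (by positivity)
      _ = 2 * |ω| * (β - x₂) + 2 * |ω| * (8 * RΛ / Real.sqrt Λ) := by ring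
      _ ≤ 2 * |ω| * (7 / 5 * Rfar) + 1 := by gcongr
      _ = 14 / 5 * (|ω| * Rfar) + 1 := by ring
  have hRfar0 : 0 ≤ Rfar := le_trans (by linarith) (le_max_left _ _)
  -- growth of the recessive branch down to `y ≤ x₁`
  have hgrowth : ∀ y, xb ≤ y → y ≤ x₁ → d y * ρ y ^ p ≤ d xb * Rb ^ p := fun y hy hy1 ↦ by
    have h := rpow_mul_le_of_angularBarrier hρ hMa hadm hΛ (by linarith) hxb7 hx₂ hx₂β hd
      (fun s hs ↦ ⟨(hsign s hs).2.2.1, (hsign s hs).2.2.2⟩) hy (by rw [← hx₁]; exact hmono hy1)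
    rwa [hxb] at h
  have hQ : 0 < Rb ^ p := Real.rpow_pos_of_pos hRb0 _
  rcases le_total x' β with hx'β | hβx'
  · -- the point is inside the barrier
    have hx'I : x' ∈ Icc xb β := ⟨hxbx', hx'β⟩
    have h2pt := norm_mul_le_of_right_flux hxbβ hw₀pos hg hd hgα hdβ hd'β rfl hW
      (hsign xb (left_mem_Icc.2 hxbβ)).2.2.1
      (fun s hs ↦ ⟨zero_le_one.trans (hsign s hs).1, zero_le_one.trans (hsign s hs).2.2.1⟩)
      hvI (hflux β) hω hP₁ hdeep hx'I
    rw [hΘ] at h2pt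
    set y := min x' x₁ with hy
    have hρy : ρ y = min (ρ x') RΛ := by rw [hy, hmono.map_min, hx₁]
    have hxby : xb ≤ y := le_min hxbx' hxb1
    have hyx' : y ≤ x' := min_le_left _ _
    have hyI : y ∈ Icc xb β := ⟨hxby, hyx'.trans hx'β⟩
    have hG := hgrowth y hxby (min_le_right _ _)
    rw [hρy] at hG
    rw [Real.div_rpow (le_min (hRb0.le.trans hx') hRΛ0.le) hRb0.le]
    refine inside_bookkeeping (norm_nonneg _) (zero_lt_one.trans_le (hsign xb (left_mem_Icc.2 hxbβ)).2.2.1) (hsign x' hx'I).2.2.1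
      (hdm hyI hx'I hyx') (zero_le_one.trans (hsign x' hx'I).1) (hgm hx'I (right_mem_Icc.2 hxbβ) hx'β)
      (by positivity) (Real.rpow_nonneg (le_min (hRb0.le.trans hx') hRΛ0.le) _) hQ h2pt hG ?_
    linarith only [hΘg, mul_nonneg hω0.le hRfar0]
  · -- the point is beyond the turning point: far envelope against the total growth `d(x_b)`
    have hx'7 : 7 * M ≤ ρ x' := hβ7.trans (hmono hβx')
    have hfar : ‖v x'‖ ≤ 2 + 2 * |ω| * Rfar :=
      carter_far_norm_le hρ hMa hω hadm hv hlim hlim₁ hx'7 fun s hs ↦ hpos s (hβx'.trans hs)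
    have hleft := abs_flux_mul_le_of_right_flux hxbβ hw₀pos hg hd hgα hdβ hd'β rfl hW
      (hsign xb (left_mem_Icc.2 hxbβ)).2.2.1 hvI (hflux β) hω hP₁ hdeep
    have hdb : d xb ≤ 3 * ‖v xb‖ := by
      have hs2 : Real.sqrt 2 ≤ 3 / 2 := by
        rw [Real.sqrt_le_left (by norm_num)]; norm_num
      have h1 : |ω| * d xb ≤ |ω| * (2 * Real.sqrt 2 * ‖v xb‖) := by
        calc |ω| * d xb ≤ 2 * (Real.sqrt 2 * |ω|) * ‖v xb‖ := hleft
          _ = |ω| * (2 * Real.sqrt 2 * ‖v xb‖) := by ring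
      have h2 := le_of_mul_le_mul_left h1 hω0
      calc d xb ≤ 2 * Real.sqrt 2 * ‖v xb‖ := h2
        _ ≤ 2 * (3 / 2) * ‖v xb‖ := by gcongr
        _ = 3 * ‖v xb‖ := by ring
    have hmin : min (ρ x') RΛ = RΛ := min_eq_right (by
      have := hmono (hx₂β.trans hβx'); rw [hx₂] at this; linarith)
    rw [hmin, Real.div_rpow hRΛ0.le hRb0.le]
    have hG := hgrowth x₁ hxb1 le_rfl
    rw [hx₁] at hG
    have hd1 : 1 ≤ d x₁ := (hsign x₁ ⟨hxb1, hx12.trans hx₂β⟩).2.2.1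
    have hPQ : RΛ ^ p ≤ d xb * Rb ^ p :=
      le_trans (le_mul_of_one_le_left (Real.rpow_nonneg hRΛ0.le _) hd1) hG
    have key := far_bookkeeping (norm_nonneg (v x')) hfar
      (zero_le_one.trans (hsign xb (left_mem_Icc.2 hxbβ)).2.2.1) hdb hQ hPQ
    calc ‖v x'‖ * (RΛ ^ p / Rb ^ p) ≤ 3 * (2 + 2 * |ω| * Rfar) * ‖v xb‖ := key
      _ = (6 + 6 * |ω| * Rfar) * ‖v xb‖ := by ring

end Tortoise

/-! ### The decay estimate for the normalised radial Teukolsky solution -/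

/-- **Inward growth of `R_𝓘` through the angular barrier, `R`-language.** For `0 < M`, `|a| < M`,
admissible `(ω, m, Λ)` with `ω ≠ 0`, `256·ω²R_Λ² ≤ Λ`, `Λ ≥ 64`, `7M ≤ R_b ≤ R_Λ`, the radial Teukolsky
solution `R_𝓘` (`s = 0`, `λ = Λ − a²ω²`) normalised at `𝓘⁺` satisfies, for every `r′ ≥ R_b`,
`√(r′² + a²)‖R_𝓘 r′‖·(min(r′, R_Λ)/R_b)^{√Λ/8} ≤ (6 + 6|ω|R_far)·√(R_b² + a²)‖R_𝓘 R_b‖`,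
`R_far = max(7M, √(12Λ)/|ω|, 1/(Mω²))` (`angularBarrier_decay` along a tortoise radius, for
`u_𝓘 = √(ρ² + a²)·R_𝓘 ∘ ρ` with the `𝓘⁺` data of `Costa2019.infinity_data_of_radial`). [folklore] -/
theorem angularBarrier_decay_radial {M a ω Λ : ℝ} {m : ℤ} (hMa : IsSubextremal M a)
    (hadm : IsAdmissibleTriple a ω m Λ) (hω : ω ≠ 0) {RΛ Rb : ℝ}
    (hΛ : 256 * (ω ^ 2 * RΛ ^ 2) ≤ Λ) (hΛ64 : 64 ≤ Λ) (hRb : 7 * M ≤ Rb) (hRbΛ : Rb ≤ RΛ)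
    {RI : ℝ → ℂ} (hRI : IsRadialTeukolskySolution M a 0 ω m (Λ - a ^ 2 * ω ^ 2) RI)
    (hnI : IsNormalisedInfinitySolution M 0 ω RI) {r' : ℝ} (hr' : Rb ≤ r') :
    Real.sqrt (r' ^ 2 + a ^ 2) * ‖RI r'‖ * (min r' RΛ / Rb) ^ (Real.sqrt Λ / 8) ≤
      (6 + 6 * |ω| * max (7 * M) (max (Real.sqrt (12 * Λ) / |ω|) (1 / (M * ω ^ 2)))) *
        (Real.sqrt (Rb ^ 2 + a ^ 2) * ‖RI Rb‖) := by
  have hM : 0 < M := hMa.pos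
  have ha : |a| < M := hMa
  -- Carter's variable
  obtain ⟨ρ, hρ⟩ := exists_isTortoiseRadius hMa
  have hrp : rPlus M a < Rb := by linarith [rPlus_le_two_mul_self hM.le a]
  obtain ⟨xb, hxb⟩ := hρ.exists_apply_eq hrp
  obtain ⟨x', hx'⟩ := hρ.exists_apply_eq (hrp.trans_le hr')
  obtain ⟨u₁, hdu, hu₁⟩ := Costa2019.carter_equation_of_radial hM ha hRI hρ
  obtain ⟨hlim, hlim₁, hflux⟩ := Costa2019.infinity_data_of_radial hM hMa hω hRI hnI hρ hu₁
  have key := angularBarrier_decay hρ hMa hadm hω hΛ hΛ64 hRb hRbΛ hdu hlim hlim₁ hflux hxb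
    (x' := x') (by rw [hx']; exact hr')
  rw [Costa2019.norm_sqrt_weight_mul, Costa2019.norm_sqrt_weight_mul, hx', hxb] at key
  exact key

end Kerr

end Literature.Geometry.Lorentzian

end
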